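import Literature.NumberTheory.Rogawski1990.ArchCentralValueTransferExists       -- ★ p832777: `ArchCentralValueTransfer` ((S-d) at fixed measures)
import Literature.NumberTheory.Rogawski1990.LocalTransferRescaleCM              -- ★ `stableOrbitalIntegralRel_smul`, `IsAdmissibleOn.smul`
import Literature.NumberTheory.Automorphic.LocalStableOrbitalFinite             -- ★ `stableOrbitalIntegralRel_smul_fun`
import Literature.NumberTheory.Automorphic.OrbitalMeasureQuotientOfPointHaarChange  -- ★ `quotientMeasure_nnreal_smul_haar`, `isHaarMeasure_eq_haarScalarFactor_smul`
import Literature.NumberTheory.Rogawski1990.ArchTestKcPackage                   -- ★ `exists_archSmoothBump_support_subset`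
import Literature.NumberTheory.QuadraticForms.LandherrHermitianDefinitePlace    -- ★ p826840: a definite complex place (`S₀ ≠ ∅`)
import HarnessLib

/-!
# The (S-d) RAY THEOREM: the archimedean central-value identity pins the Haar measure of `G_∞` — given `ν′`, the predicate
# ★ `ArchCentralValueTransfer L H′ T ν′ ν ν_H` holds for AT MOST ONE Haar measure `ν` as soon as the thirteen-conjunct letter #77 holds at `(ν′, ν, ν_H)`
(Rogawski, *Automorphic Representations of Unitary Groups in Three Variables* (1990), §1.7 p. 6 «`dg = c|Ω|`, `dg′ = c|Ω′|`», §14.2 (14.2.1) pp. 232–233,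
§14.5 p. 239 «`f′_v(γ₀) = f_v(γ₀)`»)

Topic `NumberTheory/Rogawski1990`; namespace `Literature.NumberTheory.Rogawski1990`.  THEOREMS ONLY (no definition, no instance, no named fact, no notation,
no `sorry`).  Cell `pub/hodgecm-mathlib`, ENGINE T1 (crux H413 = `stmt-HodgeConjecture-24833`); author F0P3a-p06 (g8) (T6-L2 pen).  A WITNESS OF WEAKNESS for the
letter shape of record: WHY (S-d) is booked as ★ `ArchCentralValueTransferExists L H′ T ν′ ν_H = ∃ ν (Haar, right-invariant), ArchCentralValueTransfer L H′ T ν′ ν ν_H`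
(★ p832777) and why T6-L2 ED. 6 junctions `∃ν` (`archTransfersExistCanonicalSingular_of_stubs_of_closed`) — the referee's erratum R1-162-O2 on ★
`TransferFactsCanonicalSingular` («for a given `ν′` the fact holds on EXACTLY ONE ray of `ν`») made a kernel-checked theorem.  Books count-neutral; no line
edition; nothing here proves (S-d).

THE ARGUMENT (R1-162-O2).  If `(m′, m, m_H, t′, t, t_H)` is a thirteen-conjunct system (★ `ArchTransfersExistCanonical`) at `(ν′, ν₁, ν_H)` and `ν₂ = c•ν₁`
(`c > 0`; any two Haar measures on `G_∞` are proportional), then `(m′, c•m, m_H, t′, t, t_H)` is a thirteen-conjunct system at `(ν′, ν₂, ν_H)`: admissibility and the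
Weil form `c•m = d(c•ν₁)∕dt` rescale (★ `IsAdmissibleOn.smul`, ★ `quotientMeasure_nnreal_smul_haar`), the torus transports (C′)(C)(C′G)(C_H) do not read `m`, and an
inner-transfer pair `(a′, a)` for `(m′, m)` gives the pair `(a′, c⁻¹•a)` for `(m′, c•m)` (`Φ^st` is linear in the measure family and in the function).  Reading (S-d) at
`ν₁` on `(a′, a)` and at `ν₂` on `(a′, c⁻¹•a)` at the central point `γ₀ = γ = 1` gives `a(1) = a′(1)` and `c⁻¹·a(1) = a′(1)`; with `a′` a smooth bump at `1`
(`a′(1) = 1`, ★ `exists_archSmoothBump_support_subset`) this forces `c = 1`.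

* §1 (generic locally compact `G`) `OrbitalMeasureFamily.IsQuotientOf.smul_of_eq_nnreal_smul` — the Weil form rescales: `m = dν₁∕dt ⇒ c•m = dν₂∕dt` for `ν₂ = c•ν₁`.
* §2 (abstract relation, then the `arch` dress) `IsInnerTransferRel.smul_measure_right` ∕ `IsInnerTransferExistsRel.smul_measure_right` — (14.2.1) for
  `(m′, κ•m, f′, κ.toReal⁻¹•f)` from `(m′, m, f′, f)`; `ArchSmooth.smul`; `IsArchInnerTransferExists.smul_measure_right`; `exists_archSmooth_apply_one_eq_one`
  (a smooth compactly supported `a′` on `G′_∞` with `a′(1) = 1`, ★ `exists_archSmoothBump_support_subset`); `ennreal_coe_smul_measure_eq` (the two scalar actions).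
* §3 **`ArchCentralValueTransfer.measure_eq`** — for Haar right-invariant `ν′, ν₁, ν₂, ν_H`, hermitian anisotropic `H′`: `ArchTransfersExistCanonical L H′ T ν′ ν₁ ν_H →
  ArchCentralValueTransfer L H′ T ν′ ν₁ ν_H → ArchCentralValueTransfer L H′ T ν′ ν₂ ν_H → ν₂ = ν₁`; **`not_forall_archCentralValueTransfer`** — hence the `∀ν`-closure
  of (S-d) is FALSE at every frame where #77 holds (`ν` and `2•ν` cannot both satisfy it): the letter must be, and is, `∃ν`.
HONEST LABEL: HC_CM is proved only modulo the printed citations until rung 0 closes; this file is unconditional and proves no printed statement.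

## References
* [Rogawski1990] J. D. Rogawski, *Automorphic Representations of Unitary Groups in Three Variables*, Ann. of Math. Stud. 123 (1990), §1.7 p. 6, §14.2 (14.2.1)
  pp. 232–233, §14.5 p. 239.
* [DeitmarEchterhoff2014] A. Deitmar, S. Echterhoff, *Principles of Harmonic Analysis*, 2nd ed. (2014), Thm. 1.5.3 (Weil's quotient measure; uniqueness up to a scalar).
-/

noncomputable section

open MeasureTheory Measure NumberField NumberField.InfinitePlace IsDedekindDomain Filter Topology
open Literature.MeasureTheory.Group
open scoped ENNReal NNReal Matrix ComplexOrder Classical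

/-! ## §1 The Weil form under a rescaling of the ambient Haar measure -/

namespace Literature.NumberTheory.Automorphic

section QuotientSmul

variable {G : Type*} [Group G] [TopologicalSpace G] [IsTopologicalGroup G] [LocallyCompactSpace G]
  [SecondCountableTopology G] [T2Space G] [MeasurableSpace G] [BorelSpace G]
  [∀ γ : G, MeasurableSpace (G ⧸ Subgroup.centralizer ({γ} : Set G))]
  [∀ γ : G, BorelSpace (G ⧸ Subgroup.centralizer ({γ} : Set G))]

omit [TopologicalSpace G] [IsTopologicalGroup G] [LocallyCompactSpace G] [SecondCountableTopology G] [T2Space G] [BorelSpace G]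
  [∀ γ : G, MeasurableSpace (G ⧸ Subgroup.centralizer ({γ} : Set G))] [∀ γ : G, BorelSpace (G ⧸ Subgroup.centralizer ({γ} : Set G))] in
/-- `(c : ℝ≥0∞) • μ = c • μ` for `c : ℝ≥0` (the two scalar actions on measures agree). [cite: DeitmarEchterhoff2014, Thm. 1.5.3] -/
theorem ennreal_coe_smul_measure_eq {α : Type*} [MeasurableSpace α] (c : ℝ≥0) (μ : Measure α) :
    ((c : ℝ≥0∞) • μ : Measure α) = c • μ := by
  ext s _
  rw [Measure.smul_apply, Measure.smul_apply, ENNReal.smul_def]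

/-- **The Weil form rescales with the ambient Haar measure**: if `m = dν₁∕dt` on the `P`-classes (★ `OrbitalMeasureFamily.IsQuotientOf`) and `ν₂ = c•ν₁` with
`c ≠ 0`, then `c•m = dν₂∕dt` on the `P`-classes (★ `quotientMeasure_nnreal_smul_haar`: `d(c ν)∕dρ = c · dν∕dρ`). [cite: DeitmarEchterhoff2014, Thm. 1.5.3]
[cite: Rogawski1990, §1.7 p. 6; §4.3 (4.3.1) p. 43] -/
theorem OrbitalMeasureFamily.IsQuotientOf.smul_of_eq_nnreal_smul {P : G → Prop}
    {ν₁ : Measure G} [ν₁.IsHaarMeasure] [ν₁.IsMulRightInvariant]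
    {ν₂ : Measure G} [IsFiniteMeasureOnCompacts ν₂] [ν₂.IsMulRightInvariant]
    {t : ∀ γ : G, Measure (Subgroup.centralizer ({γ} : Set G))} {m : OrbitalMeasureFamily G}
    (h : m.IsQuotientOf P ν₁ t) {c : ℝ≥0} (hc : c ≠ 0) (hν : ν₂ = c • ν₁) :
    OrbitalMeasureFamily.IsQuotientOf P ν₂ t (HSMul.hSMul (c : ℝ≥0∞) m) := by
  intro cl hP
  obtain ⟨hHaar, hInv, hm⟩ := h cl hP
  refine ⟨hHaar, hInv, ?_⟩
  subst hν
  haveI : IsClosed ((Subgroup.centralizer ({(Quotient.out cl : G)} : Set G) : Subgroup G) : Set G) :=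
    isClosed_coe_centralizer_singleton (Quotient.out cl)
  haveI : LocallyCompactSpace (Subgroup.centralizer ({(Quotient.out cl : G)} : Set G)) :=
    (isClosed_coe_centralizer_singleton (Quotient.out cl)).isClosedEmbedding_subtypeVal.locallyCompactSpace
  haveI : SecondCountableTopology (Subgroup.centralizer ({(Quotient.out cl : G)} : Set G)) :=
    TopologicalSpace.Subtype.secondCountableTopology _
  have key := quotientMeasure_nnreal_smul_haar (Subgroup.centralizer ({(Quotient.out cl : G)} : Set G)) (t (Quotient.out cl)) ν₁ c hc
  rw [OrbitalMeasureFamily.smul_apply, hm, ennreal_coe_smul_measure_eq]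
  exact key.symm

end QuotientSmul

end Literature.NumberTheory.Automorphic

namespace Literature.NumberTheory.Rogawski1990

open Literature.NumberTheory.Automorphic Literature.NumberTheory.GaloisRepresentations
open Literature.AlgebraicGeometry.ShimuraVarieties (unitaryGroup hermForm)

/-! ## §2 (14.2.1) under a rescaling of ONE measure family, compensated on the function -/

section Abstract

variable {A B : Type*} [Group A] [Group B] [∀ γ : A, MeasurableSpace (A ⧸ Subgroup.centralizer ({γ} : Set A))]
  [∀ γ : B, MeasurableSpace (B ⧸ Subgroup.centralizer ({γ} : Set B))]

/-- **(14.2.1) for `(m′, κ•m)` from (14.2.1) for `(m′, m)`, compensating on the function**: if `f′ → f` for `(m′, m)` then `f′ → κ.toReal⁻¹ • f` for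
`(m′, κ•m)` (`κ ≠ 0, ⊤`; `Φ^st` is linear in the family, ★ `stableOrbitalIntegralRel_smul`, and in the function, ★ `stableOrbitalIntegralRel_smul_fun`).
[cite: Rogawski1990, §14.2 (14.2.1) p. 232; §4.1 (4.1.1) p. 39] -/
theorem IsInnerTransferRel.smul_measure_right {corr : B → A → Prop} {stB : B → B → Prop} {stA : A → A → Prop} {regA : A → Prop}
    {m' : OrbitalMeasureFamily B} {m : OrbitalMeasureFamily A} {f' : B → ℂ} {f : A → ℂ}
    (h : IsInnerTransferRel corr stB stA regA m' m f' f) {κ : ℝ≥0∞} (h0 : κ ≠ 0) (htop : κ ≠ ⊤) :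
    IsInnerTransferRel corr stB stA regA m' (HSMul.hSMul κ m) f' (((κ.toReal : ℂ))⁻¹ • f) := by
  have hκ : (κ.toReal : ℂ) ≠ 0 := by exact_mod_cast (ENNReal.toReal_pos h0 htop).ne'
  intro γ hγ
  obtain ⟨h1, h2⟩ := h γ hγ
  refine ⟨fun γ' hc => ?_, fun hno => ?_⟩
  · rw [stableOrbitalIntegralRel_smul, stableOrbitalIntegralRel_smul_fun, h1 γ' hc, ← mul_assoc, mul_inv_cancel₀ hκ, one_mul]
  · rw [stableOrbitalIntegralRel_smul, stableOrbitalIntegralRel_smul_fun, h2 hno, mul_zero, mul_zero]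

/-- **The ∃-form**: if every `f′ ∈ Smooth_B` has a partner in `Smooth_A` for `(m′, m)` and `Smooth_A` is closed under scalars, then every `f′` has a partner for
`(m′, κ•m)` (`κ ≠ 0, ⊤`). [cite: Rogawski1990, §14.2 (14.2.1) pp. 232–233] -/
theorem IsInnerTransferExistsRel.smul_measure_right {corr : B → A → Prop} {stB : B → B → Prop} {stA : A → A → Prop} {regA : A → Prop}
    {m' : OrbitalMeasureFamily B} {m : OrbitalMeasureFamily A} {SmoothB : (B → ℂ) → Prop} {SmoothA : (A → ℂ) → Prop}
    (h : IsInnerTransferExistsRel corr stB stA regA m' m SmoothB SmoothA) (hA : ∀ (z : ℂ) (f : A → ℂ), SmoothA f → SmoothA (z • f))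
    {κ : ℝ≥0∞} (h0 : κ ≠ 0) (htop : κ ≠ ⊤) :
    IsInnerTransferExistsRel corr stB stA regA m' (HSMul.hSMul κ m) SmoothB SmoothA := fun f' hf' => by
  obtain ⟨f, hf, hrel⟩ := h f' hf'
  exact ⟨_, hA _ f hf, hrel.smul_measure_right h0 htop⟩

end Abstract

section Arch

variable (L : Type) [Field L] [NumberField L] [IsCMField L]

/-- **`C_c^∞(U(H)(L⁺ ⊗ ℝ))` (★ `ArchSmooth`, by restriction) is closed under scalars** (`z • φ` is continuous, compactly supported and arch-smooth with `φ`,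
★ `IsArchSmooth.smul`). [cite: Rogawski1990, §14.2 p. 233] [cite: BorelJacquet1979, §4.1] -/
theorem ArchSmooth.smul {N : ℕ} {H : Matrix (Fin N) (Fin N) L}
    {a : UnitaryGroup.arch (↥(maximalRealSubfield L)) L (IsCMField.complexConj L) N H → ℂ} (ha : ArchSmooth L N H a) (z : ℂ) :
    ArchSmooth L N H (z • a) := by
  obtain ⟨φ, hφc, hφs, hφsm, hφa⟩ := ha
  refine ⟨z • φ, hφc.const_smul z, ?_, IsArchSmooth.smul _ z hφsm, fun k => ?_⟩
  · exact hφs.smul_left (f := fun _ => z)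
  · simp only [Pi.smul_apply, hφa k]

variable (H' : Matrix (Fin 3) (Fin 3) L)

/-- **The ∃-form of (14.2.1) at `∞` on smooth test functions survives `m ↦ κ•m`** (`κ ≠ 0, ⊤`; partner `a ↦ κ.toReal⁻¹ • a`, ★ `ArchSmooth.smul`).
[cite: Rogawski1990, §14.2 (14.2.1) pp. 232–233] -/
theorem IsArchInnerTransferExists.smul_measure_right
    {_hγ' : ∀ γ : UnitaryGroup.arch (↥(maximalRealSubfield L)) L (IsCMField.complexConj L) 3 H',
      MeasurableSpace (UnitaryGroup.arch (↥(maximalRealSubfield L)) L (IsCMField.complexConj L) 3 H' ⧸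
        Subgroup.centralizer ({γ} : Set (UnitaryGroup.arch (↥(maximalRealSubfield L)) L (IsCMField.complexConj L) 3 H')))}
    {_hγ : ∀ γ : UnitaryGroup.arch (↥(maximalRealSubfield L)) L (IsCMField.complexConj L) 3
        (Matrix.of fun i j : Fin 3 => if i.val + j.val + 1 = 3 then (1 : L) else 0),
      MeasurableSpace (UnitaryGroup.arch (↥(maximalRealSubfield L)) L (IsCMField.complexConj L) 3
          (Matrix.of fun i j : Fin 3 => if i.val + j.val + 1 = 3 then (1 : L) else 0) ⧸
        Subgroup.centralizer ({γ} : Set (UnitaryGroup.arch (↥(maximalRealSubfield L)) L (IsCMField.complexConj L) 3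
          (Matrix.of fun i j : Fin 3 => if i.val + j.val + 1 = 3 then (1 : L) else 0))))}
    {m' : OrbitalMeasureFamily (UnitaryGroup.arch (↥(maximalRealSubfield L)) L (IsCMField.complexConj L) 3 H')}
    {m : OrbitalMeasureFamily (UnitaryGroup.arch (↥(maximalRealSubfield L)) L (IsCMField.complexConj L) 3
      (Matrix.of fun i j : Fin 3 => if i.val + j.val + 1 = 3 then (1 : L) else 0))}
    (h : IsArchInnerTransferExists L H' m' m (ArchSmooth L 3 H')
      (ArchSmooth L 3 (Matrix.of fun i j : Fin 3 => if i.val + j.val + 1 = 3 then (1 : L) else 0)))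
    {κ : ℝ≥0∞} (h0 : κ ≠ 0) (htop : κ ≠ ⊤) :
    IsArchInnerTransferExists L H' m' (HSMul.hSMul κ m) (ArchSmooth L 3 H')
      (ArchSmooth L 3 (Matrix.of fun i j : Fin 3 => if i.val + j.val + 1 = 3 then (1 : L) else 0)) :=
  IsInnerTransferExistsRel.smul_measure_right h (fun z _ hf => ArchSmooth.smul L hf z) h0 htop

/-- **A smooth compactly supported test function on `G′_∞ = U(H′)(L⁺ ⊗ ℝ)` with value `1` at the identity** (★ `exists_archSmoothBump_support_subset` restricted along
the closed subgroup `U(H′)(L⁺ ⊗ ℝ) ≤ GL₃(L ⊗ ℝ)`). [cite: Borel1972, 3.4] [cite: Rogawski1990, §14.2 p. 233] -/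
theorem exists_archSmooth_apply_one_eq_one :
    ∃ a' : UnitaryGroup.arch (↥(maximalRealSubfield L)) L (IsCMField.complexConj L) 3 H' → ℂ, ArchSmooth L 3 H' a' ∧ a' 1 = 1 := by
  obtain ⟨β, hβc, hβs, hβsm, -, hβ1, -⟩ := exists_archSmoothBump_support_subset L
    (V := (Set.univ : Set (GL (Fin 3) (mixedEmbedding.mixedSpace L)))) Filter.univ_mem
  refine ⟨fun k => ((β (k : GL (Fin 3) (mixedEmbedding.mixedSpace L)) : ℝ) : ℂ),
    ⟨fun u => ((β u : ℝ) : ℂ), Complex.continuous_ofReal.comp hβc, ?_, hβsm, fun _ => rfl⟩, ?_⟩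
  · exact hβs.comp_left Complex.ofReal_zero
  · simp only [OneMemClass.coe_one, hβ1, Complex.ofReal_one]

variable (T : ArchTransferFactor L H')
  [MeasurableSpace (UnitaryGroup.arch (↥(maximalRealSubfield L)) L (IsCMField.complexConj L) 3 H')]
  [BorelSpace (UnitaryGroup.arch (↥(maximalRealSubfield L)) L (IsCMField.complexConj L) 3 H')]
  [MeasurableSpace (UnitaryGroup.arch (↥(maximalRealSubfield L)) L (IsCMField.complexConj L) 3
    (Matrix.of fun i j : Fin 3 => if i.val + j.val + 1 = 3 then (1 : L) else 0))]
  [BorelSpace (UnitaryGroup.arch (↥(maximalRealSubfield L)) L (IsCMField.complexConj L) 3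
    (Matrix.of fun i j : Fin 3 => if i.val + j.val + 1 = 3 then (1 : L) else 0))]
  [MeasurableSpace (UnitaryGroup.arch (↥(maximalRealSubfield L)) L (IsCMField.complexConj L) 2
          (Matrix.of fun i j : Fin 2 => if i.val + j.val + 1 = 2 then (1 : L) else 0) ×
        UnitaryGroup.arch (↥(maximalRealSubfield L)) L (IsCMField.complexConj L) 1
          (Matrix.of fun i j : Fin 1 => if i.val + j.val + 1 = 1 then (1 : L) else 0))]
  [BorelSpace (UnitaryGroup.arch (↥(maximalRealSubfield L)) L (IsCMField.complexConj L) 2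
          (Matrix.of fun i j : Fin 2 => if i.val + j.val + 1 = 2 then (1 : L) else 0) ×
        UnitaryGroup.arch (↥(maximalRealSubfield L)) L (IsCMField.complexConj L) 1
          (Matrix.of fun i j : Fin 1 => if i.val + j.val + 1 = 1 then (1 : L) else 0))]
  (ν' : Measure (UnitaryGroup.arch (↥(maximalRealSubfield L)) L (IsCMField.complexConj L) 3 H'))
  (ν₁ ν₂ : Measure (UnitaryGroup.arch (↥(maximalRealSubfield L)) L (IsCMField.complexConj L) 3
    (Matrix.of fun i j : Fin 3 => if i.val + j.val + 1 = 3 then (1 : L) else 0)))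
  (νH : Measure (UnitaryGroup.arch (↥(maximalRealSubfield L)) L (IsCMField.complexConj L) 2
          (Matrix.of fun i j : Fin 2 => if i.val + j.val + 1 = 2 then (1 : L) else 0) ×
        UnitaryGroup.arch (↥(maximalRealSubfield L)) L (IsCMField.complexConj L) 1
          (Matrix.of fun i j : Fin 1 => if i.val + j.val + 1 = 1 then (1 : L) else 0)))
  [IsFiniteMeasureOnCompacts ν'] [ν'.IsMulRightInvariant] [ν₁.IsHaarMeasure] [ν₁.IsMulRightInvariant]
  [ν₂.IsHaarMeasure] [ν₂.IsMulRightInvariant] [IsFiniteMeasureOnCompacts νH] [νH.IsMulRightInvariant]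

/-! ## §3 The ray theorem -/

/-- **THE (S-d) RAY THEOREM** — given `ν′` (and `ν_H`), the central-value identity ★ `ArchCentralValueTransfer L H′ T ν′ ν ν_H` holds for AT MOST ONE Haar measure
`ν` on `G_∞`, as soon as the thirteen-conjunct letter ★ `ArchTransfersExistCanonical L H′ T ν′ ν₁ ν_H` holds (so that a Weil-form system with inner-transfer partners
EXISTS to test it on): if it holds at the Haar measures `ν₁` and `ν₂` then `ν₂ = ν₁`.  (Print: `dg = c|Ω|` on `G` with THE SAME `c` as `dg′ = c|Ω′|` on `G′`, §1.7 p. 6;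
the referee's erratum R1-162-O2 on ★ `TransferFactsCanonicalSingular`.)  Proof: `ν₂ = c•ν₁`; rescale the system's `m` to `c•m` (a system for `ν₂`) and an
inner-transfer pair `(a′, a)` to `(a′, c⁻¹•a)`; (S-d) at the central point `1` for both pairs with `a′(1) = 1` forces `c = 1`.
[cite: Rogawski1990, §1.7 p. 6; §14.2 (14.2.1) pp. 232–233; §14.5 p. 239] [cite: DeitmarEchterhoff2014, Thm. 1.5.3] -/
theorem ArchCentralValueTransfer.measure_eq (hherm : (H'.map (cmConjRingHom L)).transpose = H')
    (hanis : ∀ x : Fin 3 → L, hermForm (cmConjRingHom L) H' x x = 0 → x = 0)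
    (h77 : ArchTransfersExistCanonical L H' T ν' ν₁ νH)
    (h₁ : ArchCentralValueTransfer L H' T ν' ν₁ νH) (h₂ : ArchCentralValueTransfer L H' T ν' ν₂ νH) : ν₂ = ν₁ := by
  -- the orbit σ-algebras are Borel (as inside ★ `ArchTransfersExistCanonical`), fixed as LOCAL instances so that every synthesis below agrees with `h77`'s
  letI iGpm : ∀ γ' : UnitaryGroup.arch (↥(maximalRealSubfield L)) L (IsCMField.complexConj L) 3 H',
      MeasurableSpace (UnitaryGroup.arch (↥(maximalRealSubfield L)) L (IsCMField.complexConj L) 3 H' ⧸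
        Subgroup.centralizer ({γ'} : Set (UnitaryGroup.arch (↥(maximalRealSubfield L)) L (IsCMField.complexConj L) 3 H'))) :=
    fun _ => borel _
  haveI iGpb : ∀ γ' : UnitaryGroup.arch (↥(maximalRealSubfield L)) L (IsCMField.complexConj L) 3 H',
      BorelSpace (UnitaryGroup.arch (↥(maximalRealSubfield L)) L (IsCMField.complexConj L) 3 H' ⧸
        Subgroup.centralizer ({γ'} : Set (UnitaryGroup.arch (↥(maximalRealSubfield L)) L (IsCMField.complexConj L) 3 H'))) :=
    fun _ => ⟨rfl⟩
  letI iGm : ∀ γ : UnitaryGroup.arch (↥(maximalRealSubfield L)) L (IsCMField.complexConj L) 3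
        (Matrix.of fun i j : Fin 3 => if i.val + j.val + 1 = 3 then (1 : L) else 0),
      MeasurableSpace (UnitaryGroup.arch (↥(maximalRealSubfield L)) L (IsCMField.complexConj L) 3
          (Matrix.of fun i j : Fin 3 => if i.val + j.val + 1 = 3 then (1 : L) else 0) ⧸
        Subgroup.centralizer ({γ} : Set (UnitaryGroup.arch (↥(maximalRealSubfield L)) L (IsCMField.complexConj L) 3
          (Matrix.of fun i j : Fin 3 => if i.val + j.val + 1 = 3 then (1 : L) else 0)))) :=
    fun _ => borel _
  haveI iGb : ∀ γ : UnitaryGroup.arch (↥(maximalRealSubfield L)) L (IsCMField.complexConj L) 3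
        (Matrix.of fun i j : Fin 3 => if i.val + j.val + 1 = 3 then (1 : L) else 0),
      BorelSpace (UnitaryGroup.arch (↥(maximalRealSubfield L)) L (IsCMField.complexConj L) 3
          (Matrix.of fun i j : Fin 3 => if i.val + j.val + 1 = 3 then (1 : L) else 0) ⧸
        Subgroup.centralizer ({γ} : Set (UnitaryGroup.arch (↥(maximalRealSubfield L)) L (IsCMField.complexConj L) 3
          (Matrix.of fun i j : Fin 3 => if i.val + j.val + 1 = 3 then (1 : L) else 0)))) :=
    fun _ => ⟨rfl⟩
  letI iHm : ∀ a : (UnitaryGroup.arch (↥(maximalRealSubfield L)) L (IsCMField.complexConj L) 2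
        (Matrix.of fun i j : Fin 2 => if i.val + j.val + 1 = 2 then (1 : L) else 0) ×
      UnitaryGroup.arch (↥(maximalRealSubfield L)) L (IsCMField.complexConj L) 1
        (Matrix.of fun i j : Fin 1 => if i.val + j.val + 1 = 1 then (1 : L) else 0)),
      MeasurableSpace ((UnitaryGroup.arch (↥(maximalRealSubfield L)) L (IsCMField.complexConj L) 2
          (Matrix.of fun i j : Fin 2 => if i.val + j.val + 1 = 2 then (1 : L) else 0) ×
        UnitaryGroup.arch (↥(maximalRealSubfield L)) L (IsCMField.complexConj L) 1
          (Matrix.of fun i j : Fin 1 => if i.val + j.val + 1 = 1 then (1 : L) else 0)) ⧸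
        Subgroup.centralizer ({a} : Set (UnitaryGroup.arch (↥(maximalRealSubfield L)) L (IsCMField.complexConj L) 2
          (Matrix.of fun i j : Fin 2 => if i.val + j.val + 1 = 2 then (1 : L) else 0) ×
        UnitaryGroup.arch (↥(maximalRealSubfield L)) L (IsCMField.complexConj L) 1
          (Matrix.of fun i j : Fin 1 => if i.val + j.val + 1 = 1 then (1 : L) else 0)))) :=
    fun _ => borel _
  haveI iHb : ∀ a : (UnitaryGroup.arch (↥(maximalRealSubfield L)) L (IsCMField.complexConj L) 2
        (Matrix.of fun i j : Fin 2 => if i.val + j.val + 1 = 2 then (1 : L) else 0) ×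
      UnitaryGroup.arch (↥(maximalRealSubfield L)) L (IsCMField.complexConj L) 1
        (Matrix.of fun i j : Fin 1 => if i.val + j.val + 1 = 1 then (1 : L) else 0)),
      BorelSpace ((UnitaryGroup.arch (↥(maximalRealSubfield L)) L (IsCMField.complexConj L) 2
          (Matrix.of fun i j : Fin 2 => if i.val + j.val + 1 = 2 then (1 : L) else 0) ×
        UnitaryGroup.arch (↥(maximalRealSubfield L)) L (IsCMField.complexConj L) 1
          (Matrix.of fun i j : Fin 1 => if i.val + j.val + 1 = 1 then (1 : L) else 0)) ⧸
        Subgroup.centralizer ({a} : Set (UnitaryGroup.arch (↥(maximalRealSubfield L)) L (IsCMField.complexConj L) 2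
          (Matrix.of fun i j : Fin 2 => if i.val + j.val + 1 = 2 then (1 : L) else 0) ×
        UnitaryGroup.arch (↥(maximalRealSubfield L)) L (IsCMField.complexConj L) 1
          (Matrix.of fun i j : Fin 1 => if i.val + j.val + 1 = 1 then (1 : L) else 0)))) :=
    fun _ => ⟨rfl⟩
  -- the scalar between the two Haar measures: `ν₂ = c • ν₁`, `c > 0`
  have hν : ν₂ = Measure.haarScalarFactor ν₂ ν₁ • ν₁ := isHaarMeasure_eq_haarScalarFactor_smul ν₁ ν₂
  have hc0 : Measure.haarScalarFactor ν₂ ν₁ ≠ 0 := (Measure.haarScalarFactor_pos_of_isHaarMeasure ν₂ ν₁).ne'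
  have hcE0 : ((Measure.haarScalarFactor ν₂ ν₁ : ℝ≥0∞)) ≠ 0 := ENNReal.coe_ne_zero.2 hc0
  have hcEtop : ((Measure.haarScalarFactor ν₂ ν₁ : ℝ≥0∞)) ≠ ⊤ := ENNReal.coe_ne_top
  -- a definite complex place (Landherr)
  have hS₀ : ∃ w : {w : InfinitePlace L // IsComplex w}, (H'.map w.1.embedding).PosDef ∨ (-H'.map w.1.embedding).PosDef :=
    Literature.NumberTheory.QuadraticForms.hermitianMatrix_exists_definite_infinitePlace_of_anisotropic L H'
      (by rw [Matrix.transpose_map]; exact hherm) hanis (Fintype.card_fin 3).ge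
  -- the thirteen-conjunct system at `(ν′, ν₁, ν_H)`
  obtain ⟨m', m, mH, t', t, tH, hi, hii, hiii, hiv, hv, hvi, hW', hW, hWH, hC', hC, hC'G, hCH⟩ := h77 hherm hanis
  -- a smooth bump at `1` on `G′_∞` and its inner-transfer partner
  obtain ⟨a', ha', ha'1⟩ := exists_archSmooth_apply_one_eq_one L H'
  obtain ⟨a, ha, hrel⟩ := hv a' ha'
  -- the central point `1` is rational central with `ζ = 1`
  have h1G' : ((((1 : (UnitaryGroup.cmDatum L 3 H').Rational) : unitaryGroup (cmConjRingHom L) H').val : GL (Fin 3) L) :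
      Matrix (Fin 3) (Fin 3) L) = (1 : L) • (1 : Matrix (Fin 3) (Fin 3) L) := by
    rw [one_smul]; exact Units.val_one
  have h1G : ((((1 : (UnitaryGroup.cmDatum L 3 (Matrix.of fun i j : Fin 3 => if i.val + j.val + 1 = 3 then (1 : L) else 0)).Rational) :
      unitaryGroup (cmConjRingHom L) (Matrix.of fun i j : Fin 3 => if i.val + j.val + 1 = 3 then (1 : L) else 0)).val : GL (Fin 3) L) :
      Matrix (Fin 3) (Fin 3) L) = (1 : L) • (1 : Matrix (Fin 3) (Fin 3) L) := by
    rw [one_smul]; exact Units.val_one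
  -- (S-d) at `ν₁` on the system and the pair `(a′, a)`, at the central point
  have e₁ : a (cmRationalToArch L 3 (Matrix.of fun i j : Fin 3 => if i.val + j.val + 1 = 3 then (1 : L) else 0) 1) = a' (cmRationalToArch L 3 H' 1) :=
    h₁ hherm hanis hS₀ m' m mH t' t tH ⟨hi, hii, hiii, hiv, hv, hvi, hW', hW, hWH, hC', hC, hC'G, hCH⟩ a' a ha' ha hrel 1 1 1 h1G' h1G
  -- (S-d) at `ν₂` on the rescaled system `(m′, c•m, m_H, t′, t, t_H)` and the pair `(a′, c⁻¹•a)`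
  have e₂ : ((((Measure.haarScalarFactor ν₂ ν₁ : ℝ≥0∞).toReal : ℂ))⁻¹ • a)
        (cmRationalToArch L 3 (Matrix.of fun i j : Fin 3 => if i.val + j.val + 1 = 3 then (1 : L) else 0) 1) =
      a' (cmRationalToArch L 3 H' 1) :=
    h₂ hherm hanis hS₀ m' (HSMul.hSMul (Measure.haarScalarFactor ν₂ ν₁ : ℝ≥0∞) m) mH t' t tH
      ⟨hi, hii.smul hcE0 hcEtop, hiii, hiv, IsArchInnerTransferExists.smul_measure_right L H' hv hcE0 hcEtop, hvi, hW',
        hW.smul_of_eq_nnreal_smul hc0 hν, hWH, hC', hC, hC'G, hCH⟩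
      a' _ ha' (ArchSmooth.smul L ha _) (hrel.smul_measure_right hcE0 hcEtop) 1 1 1 h1G' h1G
  -- compare the two readings: `a(1) = a′(1) = 1` and `c⁻¹ · a(1) = 1` force `c = 1`
  rw [map_one, map_one, ha'1] at e₁ e₂
  rw [Pi.smul_apply, smul_eq_mul, e₁, mul_one, ENNReal.coe_toReal, inv_eq_one, Complex.ofReal_eq_one, NNReal.coe_eq_one] at e₂
  rw [hν, e₂, one_smul]

/-- **COROLLARY — the `∀ν`-closure of (S-d) is FALSE wherever #77 holds**: at a frame `(L, H′, T, ν′, ν_H)` with `H′` hermitian anisotropic and the thirteen-conjunct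
letter ★ `ArchTransfersExistCanonical L H′ T ν′ ν ν_H` at some Haar right-invariant `ν`, the central-value identity cannot hold at EVERY Haar right-invariant measure
on `G_∞` (it would hold at `ν` and at `2•ν`).  This is why the (S-d) letter is booked in the `∃ν`-shape ★ `ArchCentralValueTransferExists` (p832777) and why T6-L2's
junction head ED. 6 concludes `∃ ν, …`. [cite: Rogawski1990, §1.7 p. 6; §14.5 p. 239] [cite: DeitmarEchterhoff2014, Thm. 1.5.3] -/
theorem not_forall_archCentralValueTransfer (hherm : (H'.map (cmConjRingHom L)).transpose = H')
    (hanis : ∀ x : Fin 3 → L, hermForm (cmConjRingHom L) H' x x = 0 → x = 0)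
    (h77 : ArchTransfersExistCanonical L H' T ν' ν₁ νH) :
    ¬ ∀ (μ : Measure (UnitaryGroup.arch (↥(maximalRealSubfield L)) L (IsCMField.complexConj L) 3
        (Matrix.of fun i j : Fin 3 => if i.val + j.val + 1 = 3 then (1 : L) else 0)))
        [μ.IsHaarMeasure] [μ.IsMulRightInvariant], ArchCentralValueTransfer L H' T ν' μ νH := by
  intro h
  haveI h2 : ((2 : ℝ≥0) • ν₁).IsHaarMeasure := IsHaarMeasure.nnreal_smul ν₁ two_ne_zero
  have heq : ((2 : ℝ≥0) • ν₁ : Measure _) = ν₁ :=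
    ArchCentralValueTransfer.measure_eq L H' T ν' ν₁ ((2 : ℝ≥0) • ν₁) νH hherm hanis h77 (h ν₁) (h ((2 : ℝ≥0) • ν₁))
  -- `2 • ν₁ = ν₁` is absurd for a Haar measure (positive finite mass on a compact neighbourhood)
  haveI : Nonempty (UnitaryGroup.arch (↥(maximalRealSubfield L)) L (IsCMField.complexConj L) 3
    (Matrix.of fun i j : Fin 3 => if i.val + j.val + 1 = 3 then (1 : L) else 0)) := ⟨1⟩
  obtain ⟨K⟩ := (TopologicalSpace.PositiveCompacts.nonempty' :
    Nonempty (TopologicalSpace.PositiveCompacts (UnitaryGroup.arch (↥(maximalRealSubfield L)) L (IsCMField.complexConj L) 3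
      (Matrix.of fun i j : Fin 3 => if i.val + j.val + 1 = 3 then (1 : L) else 0))))
  have hpos : ν₁ (K : Set _) ≠ 0 := (Measure.measure_pos_of_nonempty_interior ν₁ K.interior_nonempty).ne'
  have htop : ν₁ (K : Set _) ≠ ⊤ := K.isCompact.measure_lt_top.ne
  have h1 : ((2 : ℝ≥0) • ν₁ : Measure _) (K : Set _) = 1 * ν₁ (K : Set _) := by rw [heq, one_mul]
  rw [Measure.smul_apply, ENNReal.smul_def, smul_eq_mul] at h1
  have h3 : ((2 : ℝ≥0) : ℝ≥0∞) = 1 := (ENNReal.mul_left_inj hpos htop).1 h1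
  have h4 : (2 : ℝ≥0) = 1 := ENNReal.coe_eq_one.1 h3
  norm_num at h4

end Arch

end Literature.NumberTheory.Rogawski1990

end
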